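import Summits.NavierStokesRegularity.NavierStokesRegularity.Theses.RecurrentProfiles

/-!
# Route RecurrentProfiles — assembly `Assembly`

Item stmt-NavierStokesRegularity-1594. Pure logic: the target `NoTypeIRateProfile` (no
local-energy Type-I-rate profile is singular at the space–time origin), the support
`TypeIBlowupProfile` (a Type-I-rate blow-up of a maximal classical Leray–Hopf solution from a
rapidly decaying datum yields such a profile singular at the origin), the crux `NoTypeII` (a
maximal classical Leray–Hopf solution from a rapidly decaying datum blows up at the Type-I rate)
and the support `ClayFromNoBlowup` (no blow-up ⇒ Clay (A)) imply `NavierStokesRegularity`.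
All four hypotheses are inlined verbatim in the route decl `Assembly`. The only definitional fact
used is `IsMaximalSmoothSolution ν 0 u p T := IsClassicalNSSolutionOn (Ico 0 T) ν 0 u p ∧
¬ HasSmoothExtensionPast ν 0 u T` (anonymous constructor).
-/

set_option linter.dupNamespace false

namespace Summit.NavierStokesRegularity.NavierStokesRegularity.Theorems

/-- The assembly of route RecurrentProfiles holds: `NoTypeIRateProfile → TypeIBlowupProfile →
NoTypeII → ClayFromNoBlowup → NavierStokesRegularity`. Proof: apply `ClayFromNoBlowup`; given a
classical Leray–Hopf solution `(u, p)` on `[0, T)` from a rapidly decaying datum, suppose it has no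
smooth extension past `T`; then it is maximal, `NoTypeII` gives the Type-I rate,
`TypeIBlowupProfile` produces a local-energy class profile `w` singular at the origin, and
`NoTypeIRateProfile` says `w` is regular at the origin — contradiction. -/
theorem recurrentProfiles_assembly_proof :
    Summit.NavierStokesRegularity.NavierStokesRegularity.Theses.RecurrentProfiles.Assembly := by
  unfold Summit.NavierStokesRegularity.NavierStokesRegularity.Theses.RecurrentProfiles.Assembly
  intro hT g1 hII hClay
  apply hClay
  intro ν T hν hT' u p hcl hLH hdec
  by_contra hext
  have hmax : Literature.Analysis.FluidPDE.IsMaximalSmoothSolution ν 0 u p T := ⟨hcl, hext⟩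
  have hI : Literature.Analysis.FluidPDE.IsTypeIBlowup u T := hII ν T hν hT' u p hmax hLH hdec
  obtain ⟨w, q, H, C, hsw, hgr, hIb, hdecay, hsing⟩ := g1 ν T hν hT' u p hmax hLH hdec hI
  exact hT w q H C hsw hgr hIb hdecay hsing

end Summit.NavierStokesRegularity.NavierStokesRegularity.Theorems
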